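import Summits.Schanuel.Schanuel.Theorems.RootDecomp1PillayTupleSchanuel
import Literature.NumberTheory.Transcendental.PeriodsWave0Proofs

/-!
# RootDecomp1 — Schanuel data at `u = e^e`; the non-degeneracy binders of 30352 rel. S (lens-1 round 11 rev b, part E;
`--supports stmt-Schanuel-30352`)

Rel. Schanuel's conjecture: (i) the span-minimality binder of the residual `EntangledSaturatedEssentialSchanuel` (30352) is S
itself and the AFFINE / QUADRATIC / RATIONAL-IMAGE non-degeneracy binders hold at EVERY ℚ-l.i. tuple (`k` algebraic-coefficient
parameters put `z, e^z` inside `ℚ(t)^alg`, so `n ≤ trdeg ≤ k`: `affineNondegenerate_of_schanuel`, `quadraticNondegenerate_of_schanuel`,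
`rationalNondegenerate_of_schanuel`); (ii) Schanuel at `(e, 1)`, `(e, u², u, 1)` and `(e, v, u², u, 1)` for `u = e^e`,
`v = e^{u²} − u e^u` gives: `(e, u)`, `(e, v, u, e^u)`, `(e, u, v, e^u, e^v)` algebraically independent — hence the genericity
hypothesis of part C at `u = e^e` (`pillayHyp_expE_of_schanuel`) and `e ∉ ℚ(u, v, e^u, e^v)^alg`.
-/

set_option linter.dupNamespace false

noncomputable section

namespace Summit.Schanuel.Schanuel.Theorems.RootDecomp1ModularLayer

open Complex IntermediateField
open scoped BigOperators Cardinal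
open Summit.Schanuel.Schanuel.Theorems.RootDecomp1EAnchor (isAlgebraic_of_trdeg_sandwich trdeg_adjoin_le_of_isAlgebraic
  trdeg_adjoin_union_le trdeg_adjoin_le_nat exists_nat_eq_of_le_natCast isAlgebraic_of_mem_adjoin isAlgebraic_of_le
  isAlgebraic_of_isAlgebraic_adjoin trdeg_adjoin_sum_le_union one_le_trdeg_adjoin_singleton isAlgebraic_mul)
open Summit.Schanuel.Schanuel.Theorems.RootDecomp1ArgumentCells (le_trdeg_of_algebraicIndependent_mem)
open Summit.Schanuel.Schanuel.Theorems.RootDecomp1AtomRigidity (mem_adjoin_range_of_mem_span_int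
  exp_mem_adjoin_exp_of_mem_span_int)
open Summit.Schanuel.Schanuel.Theorems.RootDecomp1SharedDegree (trdeg_union_add_one_le_of_shared
  entangled_of_shared_transcendental lt_of_add_one_le_of_le_nat)
open Literature.NumberTheory.Transcendental (SchanuelRank transcendental_exp transcendental_exp_holds
  exists_nsmul_mem_span_int isAlgebraic_adjoin_over_algebraAdjoin transcendental_rat_cexp_one)
open Literature.NumberTheory.Transcendental.OneMotiveToric (trdeg_mono)
open Literature.Barriers.Schanuel (algebraicIndependent_of_le_trdeg_adjoin trdeg_adjoin_union_eq_of_isAlgebraic)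

/-- (private copy; the public form is a print-twin of a landed declaration — gate dedup, as in parts B/C) A field
generated by an `m`-tuple has `trdeg ≤ m`. -/
private theorem trdeg_adjoin_range_le {m : ℕ} (x : Fin m → ℂ) : Algebra.trdeg ℚ ↥(adjoin ℚ (Set.range x)) ≤ (m : Cardinal) :=
  trdeg_adjoin_le_nat _ (by simpa using Cardinal.mk_range_le (f := x))

/-! ## §2c  THE SATURATED LAYER — Pillay's tuple at `u = e^e` lies in the residual class of 30352 rel. Schanuel

Correction by decomp-schanuel-crit-1 (VERDICT 2026-08-30T12:30:23Z): at `u = e` Pillay's tuple is NOT saturated (`w = 1`: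
`1, e^1 = z₀ ∈ F_z` but `1 ∉ span_ℚ(e, v, e²)`), and its saturated hull `(1, e, e², v(e))` has the chain witness `e`.  At
`u = e^e` (critic's repair, typed here) Schanuel applied at `(e, 1)`, `(e, u², u, 1)`, `(e, v, u², u, 1)` and at the 6-tuples
`(w, e, v, u², u, 1)` gives: `PillayHyp (e^e)`, `e ∉ ℚ(u, v, e^u, e^v)^alg`, and SATURATION of `z = pillayTuple (e^e)`; the
span-minimality and the three non-degeneracy binders of 30352 hold at EVERY tuple rel. S.  Hence the residual-level NO-GO
`saturatedWitnessProgramme_refutes_schanuel`. -/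

/-! ### helpers -/

/-- If `Fin.cons y x` is algebraically independent then `y` is transcendental over `ℚ(x)`. -/
theorem not_isAlgebraic_of_algebraicIndependent_cons {n : ℕ} {x : Fin n → ℂ} {y : ℂ}
    (h : AlgebraicIndependent ℚ (Fin.cons y x : Fin (n + 1) → ℂ)) :
    ¬ IsAlgebraic ↥(adjoin ℚ (Set.range x)) y := by
  intro hy
  have h1 : ((n + 1 : ℕ) : Cardinal) ≤ Algebra.trdeg ℚ ↥(adjoin ℚ (insert y (Set.range x))) := by
    refine le_trdeg_of_algebraicIndependent_mem _ h ?_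
    intro i
    refine Fin.cases ?_ (fun j => ?_) i
    · simpa using subset_adjoin ℚ (insert y (Set.range x)) (Set.mem_insert y _)
    · simpa using subset_adjoin ℚ (insert y (Set.range x)) (Set.mem_insert_of_mem y ⟨j, rfl⟩)
  have h2 : Algebra.trdeg ℚ ↥(adjoin ℚ (insert y (Set.range x))) ≤ (n : Cardinal) :=
    (trdeg_adjoin_insert_eq_of_isAlgebraic hy).le.trans (trdeg_adjoin_range_le x)
  have : ((n + 1 : ℕ) : Cardinal) ≤ (n : Cardinal) := h1.trans h2
  have : n + 1 ≤ n := by exact_mod_cast this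
  omega

/-- A number transcendental over `ℚ(S)` lies outside the ℚ-span of any family drawn from `ℚ(S)`. -/
theorem not_mem_span_of_not_isAlgebraic {m : ℕ} {x : Fin m → ℂ} {S : Set ℂ} {y : ℂ}
    (hx : ∀ i, x i ∈ adjoin ℚ S) (hy : ¬ IsAlgebraic ↥(adjoin ℚ S) y) :
    y ∉ Submodule.span ℚ (Set.range x) := by
  intro hmem
  apply hy
  have h1 : y ∈ adjoin ℚ (Set.range x) := mem_adjoin_of_mem_span x hmem
  have hle : adjoin ℚ (Set.range x) ≤ adjoin ℚ S := adjoin_le_iff.mpr (by rintro _ ⟨i, rfl⟩; exact hx i)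
  exact isAlgebraic_of_mem_adjoin (hle h1)

/-- **SCHANUEL STEP.**  Schanuel at a ℚ-l.i. `n`-tuple `x` whose coordinates and exponentials all lie in `ℚ(g)` for an
`n`-tuple `g` makes `g` algebraically independent. -/
theorem algebraicIndependent_of_schanuel (hS : Literature.Periods.SchanuelConjecture) {n : ℕ} {x g : Fin n → ℂ} (hx : LinearIndependent ℚ x)
    (hmem : ∀ i, x i ∈ adjoin ℚ (Set.range g)) (hexp : ∀ i, cexp (x i) ∈ adjoin ℚ (Set.range g)) :
    AlgebraicIndependent ℚ g := by
  have h := hS n x hx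
  have hle : adjoin ℚ (Set.range x ∪ Set.range (cexp ∘ x)) ≤ adjoin ℚ (Set.range g) :=
    adjoin_le_iff.mpr (by rintro _ (⟨i, rfl⟩ | ⟨i, rfl⟩); exacts [hmem i, hexp i])
  exact algebraicIndependent_of_le_trdeg_adjoin _ (h.trans (trdeg_mono hle))

/-- `![1]` is ℚ-linearly independent. -/
theorem linearIndependent_single_one : LinearIndependent ℚ ![(1 : ℂ)] := by
  rw [linearIndependent_unique_iff]
  exact one_ne_zero

/-- A transcendental number is outside `span_ℚ {1} = ℚ`. -/
theorem not_mem_span_one_of_transcendental {y : ℂ} (hy : Transcendental ℚ y) :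
    y ∉ Submodule.span ℚ (Set.range ![(1 : ℂ)]) := by
  intro h
  obtain ⟨c, hc⟩ := (Submodule.mem_span_range_iff_exists_fun ℚ).mp h
  simp only [Fin.sum_univ_one, Matrix.cons_val_zero] at hc
  apply hy
  rw [← hc, Rat.smul_one_eq_cast]
  exact isAlgebraic_algebraMap (c 0)

/-! ### the three non-degeneracy binders and span-minimality of 30352 hold at every tuple rel. Schanuel -/

/-- Evaluating a polynomial with algebraic coefficients at `t` lands in `ℚ(t)^alg`. -/
theorem eval_mem_algebraicClosure {k : ℕ} (t : Fin k → ℂ) {P : MvPolynomial (Fin k) ℂ}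
    (hP : ∀ m, IsAlgebraic ℚ (MvPolynomial.coeff m P)) :
    MvPolynomial.eval t P ∈ algebraicClosure ↥(adjoin ℚ (Set.range t)) ℂ := by
  rw [MvPolynomial.eval_eq]
  refine sum_mem fun d _ => mul_mem ?_ (prod_mem fun i _ => pow_mem ?_ _)
  · exact mem_algebraicClosure_iff.mpr (IsAlgebraic.tower_top _ (hP d))
  · exact mem_algebraicClosure_iff.mpr (isAlgebraic_of_mem_adjoin (subset_adjoin ℚ _ ⟨i, rfl⟩))

/-- An affine combination with algebraic coefficients of the parameters lies in `ℚ(t)^alg`. -/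
theorem affine_mem_algebraicClosure {k : ℕ} (t : Fin k → ℂ) {b₀ : ℂ} {b : Fin k → ℂ} (h₀ : IsAlgebraic ℚ b₀)
    (h : ∀ j, IsAlgebraic ℚ (b j)) :
    b₀ + ∑ j, b j * t j ∈ algebraicClosure ↥(adjoin ℚ (Set.range t)) ℂ := by
  refine add_mem (mem_algebraicClosure_iff.mpr (IsAlgebraic.tower_top _ h₀)) (sum_mem fun j _ => mul_mem ?_ ?_)
  · exact mem_algebraicClosure_iff.mpr (IsAlgebraic.tower_top _ (h j))
  · exact mem_algebraicClosure_iff.mpr (isAlgebraic_of_mem_adjoin (subset_adjoin ℚ _ ⟨j, rfl⟩))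

/-- … and so does a quadratic one. -/
theorem quadratic_mem_algebraicClosure {k : ℕ} (t : Fin k → ℂ) {b₀ : ℂ} {b : Fin k → ℂ} {d : Fin k → Fin k → ℂ}
    (h₀ : IsAlgebraic ℚ b₀) (h : ∀ j, IsAlgebraic ℚ (b j)) (hd : ∀ j j', IsAlgebraic ℚ (d j j')) :
    b₀ + ∑ j, b j * t j + ∑ j, ∑ j', d j j' * (t j * t j') ∈ algebraicClosure ↥(adjoin ℚ (Set.range t)) ℂ := by
  refine add_mem (affine_mem_algebraicClosure t h₀ h) (sum_mem fun j _ => sum_mem fun j' _ => mul_mem ?_ (mul_mem ?_ ?_))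
  · exact mem_algebraicClosure_iff.mpr (IsAlgebraic.tower_top _ (hd j j'))
  · exact mem_algebraicClosure_iff.mpr (isAlgebraic_of_mem_adjoin (subset_adjoin ℚ _ ⟨j, rfl⟩))
  · exact mem_algebraicClosure_iff.mpr (isAlgebraic_of_mem_adjoin (subset_adjoin ℚ _ ⟨j', rfl⟩))

/-- If `z` and `e^z` are algebraic over `ℚ(t)` for a `k`-tuple `t`, then `trdeg ℚ(z, e^z) ≤ k`; with Schanuel, `n ≤ k`. -/
theorem le_of_schanuel_of_isAlgebraic_params (hS : Literature.Periods.SchanuelConjecture) {n k : ℕ} {z : Fin n → ℂ} (hz : LinearIndependent ℚ z)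
    (t : Fin k → ℂ) (h₁ : ∀ i, z i ∈ algebraicClosure ↥(adjoin ℚ (Set.range t)) ℂ)
    (h₂ : ∀ i, cexp (z i) ∈ algebraicClosure ↥(adjoin ℚ (Set.range t)) ℂ) : n ≤ k := by
  have h := hS n z hz
  have hle : Algebra.trdeg ℚ ↥(adjoin ℚ (Set.range z ∪ Set.range (cexp ∘ z))) ≤ (k : Cardinal) := by
    refine (trdeg_adjoin_le_of_isAlgebraic ?_).trans (trdeg_adjoin_range_le t)
    rintro _ (⟨i, rfl⟩ | ⟨i, rfl⟩)
    · exact mem_algebraicClosure_iff.mp (h₁ i)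
    · exact mem_algebraicClosure_iff.mp (h₂ i)
  exact_mod_cast h.trans hle

/-- **Rel. S, the AFFINE non-degeneracy binder of 30352 holds at every ℚ-l.i. tuple.** -/
theorem affineNondegenerate_of_schanuel (hS : Literature.Periods.SchanuelConjecture) {n : ℕ} {z : Fin n → ℂ} (hz : LinearIndependent ℚ z) :
    ∀ (k : ℕ) (t : Fin k → ℂ) (β₀ γ₀ : Fin n → ℂ) (β γ : Fin n → Fin k → ℂ), (∀ i, IsAlgebraic ℚ (β₀ i)) →
      (∀ i j, IsAlgebraic ℚ (β i j)) → (∀ i, IsAlgebraic ℚ (γ₀ i)) → (∀ i j, IsAlgebraic ℚ (γ i j)) →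
      (∀ i, z i = β₀ i + ∑ j, β i j * t j) → (∀ i, Complex.exp (z i) = γ₀ i + ∑ j, γ i j * t j) → n ≤ k := by
  intro k t β₀ γ₀ β γ hβ₀ hβ hγ₀ hγ hz' hez
  refine le_of_schanuel_of_isAlgebraic_params hS hz t (fun i => ?_) (fun i => ?_)
  · rw [hz' i]; exact affine_mem_algebraicClosure t (hβ₀ i) (hβ i)
  · rw [hez i]; exact affine_mem_algebraicClosure t (hγ₀ i) (hγ i)

/-- **Rel. S, the QUADRATIC non-degeneracy binder of 30352 holds at every ℚ-l.i. tuple.** -/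
theorem quadraticNondegenerate_of_schanuel (hS : Literature.Periods.SchanuelConjecture) {n : ℕ} {z : Fin n → ℂ} (hz : LinearIndependent ℚ z) :
    ∀ (k : ℕ) (t : Fin k → ℂ) (β₀ γ₀ : Fin n → ℂ) (β γ : Fin n → Fin k → ℂ) (δ ε : Fin n → Fin k → Fin k → ℂ),
      (∀ i, IsAlgebraic ℚ (β₀ i)) → (∀ i j, IsAlgebraic ℚ (β i j)) → (∀ i j j', IsAlgebraic ℚ (δ i j j')) →
      (∀ i, IsAlgebraic ℚ (γ₀ i)) → (∀ i j, IsAlgebraic ℚ (γ i j)) → (∀ i j j', IsAlgebraic ℚ (ε i j j')) →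
      (∀ i, z i = β₀ i + ∑ j, β i j * t j + ∑ j, ∑ j', δ i j j' * (t j * t j')) →
      (∀ i, Complex.exp (z i) = γ₀ i + ∑ j, γ i j * t j + ∑ j, ∑ j', ε i j j' * (t j * t j')) → n ≤ k := by
  intro k t β₀ γ₀ β γ δ ε hβ₀ hβ hδ hγ₀ hγ hε hz' hez
  refine le_of_schanuel_of_isAlgebraic_params hS hz t (fun i => ?_) (fun i => ?_)
  · rw [hz' i]; exact quadratic_mem_algebraicClosure t (hβ₀ i) (hβ i) (hδ i)
  · rw [hez i]; exact quadratic_mem_algebraicClosure t (hγ₀ i) (hγ i) (hε i)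

/-- **Rel. S, the RATIONAL-IMAGE non-degeneracy binder of 30352 holds at every ℚ-l.i. tuple.** -/
theorem rationalNondegenerate_of_schanuel (hS : Literature.Periods.SchanuelConjecture) {n : ℕ} {z : Fin n → ℂ} (hz : LinearIndependent ℚ z) :
    ∀ (k : ℕ) (t : Fin k → ℂ) (D : MvPolynomial (Fin k) ℂ) (N E : Fin n → MvPolynomial (Fin k) ℂ),
      (∀ m, IsAlgebraic ℚ (MvPolynomial.coeff m D)) → (∀ i m, IsAlgebraic ℚ (MvPolynomial.coeff m (N i))) →
      (∀ i m, IsAlgebraic ℚ (MvPolynomial.coeff m (E i))) → MvPolynomial.eval t D ≠ 0 →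
      (∀ i, z i * MvPolynomial.eval t D = MvPolynomial.eval t (N i)) →
      (∀ i, Complex.exp (z i) * MvPolynomial.eval t D = MvPolynomial.eval t (E i)) → n ≤ k := by
  intro k t D N E hD hN hE hD0 hz' hez
  have hDm := eval_mem_algebraicClosure t hD
  refine le_of_schanuel_of_isAlgebraic_params hS hz t (fun i => ?_) (fun i => ?_)
  · have : z i = MvPolynomial.eval t (N i) / MvPolynomial.eval t D := by
      rw [← hz' i, mul_div_cancel_right₀ _ hD0]
    rw [this]; exact div_mem (eval_mem_algebraicClosure t (hN i)) hDm
  · have : cexp (z i) = MvPolynomial.eval t (E i) / MvPolynomial.eval t D := by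
      rw [← hez i, mul_div_cancel_right₀ _ hD0]
    rw [this]; exact div_mem (eval_mem_algebraicClosure t (hE i)) hDm

/-! ### Schanuel data at `u = e^e` -/

/-- `e^e ∈ ecl ∅`. -/
theorem expE_mem_ecl : cexp (cexp 1) ∈ Literature.NumberTheory.Transcendental.ecl (∅ : Set ℂ) :=
  Literature.NumberTheory.Transcendental.Khovanskii.exp_mem_ecl exp_one_mem_ecl

/-- S ⟹ `(e, e^e)` algebraically independent (Schanuel at `(e, 1)`). -/
theorem algInd_e_expE_of_schanuel (hS : Literature.Periods.SchanuelConjecture) : AlgebraicIndependent ℚ ![cexp 1, cexp (cexp 1)] := by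
  refine algebraicIndependent_of_schanuel hS (x := ![cexp 1, (1 : ℂ)]) ?_ ?_ ?_
  · exact linearIndependent_finCons.mpr ⟨linearIndependent_single_one, not_mem_span_one_of_transcendental transcendental_rat_cexp_one⟩
  · intro i
    fin_cases i
    · simpa using subset_adjoin ℚ (Set.range ![cexp 1, cexp (cexp 1)]) ⟨0, by simp⟩
    · simp
  · intro i
    fin_cases i
    · simpa using subset_adjoin ℚ (Set.range ![cexp 1, cexp (cexp 1)]) ⟨1, by simp⟩
    · simpa using subset_adjoin ℚ (Set.range ![cexp 1, cexp (cexp 1)]) ⟨0, by simp⟩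

/-- S ⟹ `e^e` is transcendental. -/
theorem transcendental_expE_of_schanuel (hS : Literature.Periods.SchanuelConjecture) : Transcendental ℚ (cexp (cexp 1)) := by
  simpa using (algInd_e_expE_of_schanuel hS).transcendental 1

/-- For a transcendental `u`, `(u², u, 1)` is ℚ-linearly independent. -/
theorem linearIndependent_sq_self_one {u : ℂ} (hu : Transcendental ℚ u) : LinearIndependent ℚ ![u ^ 2, u, (1 : ℂ)] := by
  classical
  rw [Fintype.linearIndependent_iff]
  intro g hg
  simp only [Fin.sum_univ_three, Matrix.cons_val_zero, Matrix.cons_val_one, Matrix.cons_val] at hg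
  have hg' : ((g 2 : ℚ) : ℂ) + (g 1 : ℂ) * u + (g 0 : ℂ) * u ^ 2 = 0 := by
    have : ((g 0 : ℚ) : ℂ) * u ^ 2 + (g 1 : ℂ) * u + (g 2 : ℂ) * 1 = 0 := by simpa [Rat.smul_def] using hg
    linear_combination this
  have hq := quadratic_relation_trivial hu hg'
  intro i; fin_cases i
  · exact hq.2.2
  · exact hq.2.1
  · exact hq.1

/-- S ⟹ `(e, u², u, 1)` is ℚ-l.i. for `u = e^e` (`e` is transcendental over `ℚ(u)`). -/
theorem linearIndependent_e_sq_u_one_of_schanuel (hS : Literature.Periods.SchanuelConjecture) :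
    LinearIndependent ℚ ![cexp 1, cexp (cexp 1) ^ 2, cexp (cexp 1), (1 : ℂ)] := by
  refine linearIndependent_finCons.mpr ⟨linearIndependent_sq_self_one (transcendental_expE_of_schanuel hS), ?_⟩
  refine not_mem_span_of_not_isAlgebraic (S := Set.range ![cexp (cexp 1)]) ?_
    (not_isAlgebraic_of_algebraicIndependent_cons (x := ![cexp (cexp 1)]) (algInd_e_expE_of_schanuel hS))
  have hu : cexp (cexp 1) ∈ adjoin ℚ (Set.range ![cexp (cexp 1)]) := subset_adjoin ℚ _ ⟨0, by simp⟩
  intro i; fin_cases i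
  · simpa using pow_mem hu 2
  · simpa using hu
  · simp

/-- S ⟹ `(e, v(u), u, e^u)` algebraically independent for `u = e^e` (Schanuel at `(e, u², u, 1)`; `e^{u²} = u e^u + v`). -/
theorem algInd_g₂_of_schanuel (hS : Literature.Periods.SchanuelConjecture) :
    AlgebraicIndependent ℚ ![cexp 1, pillayV (cexp (cexp 1)), cexp (cexp 1), cexp (cexp (cexp 1))] := by
  have heK : cexp 1 ∈ adjoin ℚ (Set.range ![cexp 1, pillayV (cexp (cexp 1)), cexp (cexp 1), cexp (cexp (cexp 1))]) :=
    subset_adjoin ℚ _ ⟨0, by simp⟩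
  have hvK : pillayV (cexp (cexp 1)) ∈
      adjoin ℚ (Set.range ![cexp 1, pillayV (cexp (cexp 1)), cexp (cexp 1), cexp (cexp (cexp 1))]) :=
    subset_adjoin ℚ _ ⟨1, by simp⟩
  have huK : cexp (cexp 1) ∈ adjoin ℚ (Set.range ![cexp 1, pillayV (cexp (cexp 1)), cexp (cexp 1), cexp (cexp (cexp 1))]) :=
    subset_adjoin ℚ _ ⟨2, by simp⟩
  have heuK : cexp (cexp (cexp 1)) ∈
      adjoin ℚ (Set.range ![cexp 1, pillayV (cexp (cexp 1)), cexp (cexp 1), cexp (cexp (cexp 1))]) :=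
    subset_adjoin ℚ _ ⟨3, by simp⟩
  refine algebraicIndependent_of_schanuel hS (linearIndependent_e_sq_u_one_of_schanuel hS) ?_ ?_
  · intro i; fin_cases i
    · simpa using heK
    · simpa using pow_mem huK 2
    · simpa using huK
    · simp
  · intro i; fin_cases i
    · simpa using huK
    · simpa [exp_sq_eq] using add_mem (mul_mem huK heuK) hvK
    · simpa using heuK
    · simpa using heK

/-- S ⟹ `T = (e, v, u², u, 1)` is ℚ-l.i. for `u = e^e`, `v = v(u)`. -/
theorem linearIndependent_T_of_schanuel (hS : Literature.Periods.SchanuelConjecture) :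
    LinearIndependent ℚ ![cexp 1, pillayV (cexp (cexp 1)), cexp (cexp 1) ^ 2, cexp (cexp 1), (1 : ℂ)] := by
  set e : ℂ := cexp 1 with he
  set u : ℂ := cexp (cexp 1) with hu
  have hg := algInd_g₂_of_schanuel hS
  -- `(v, u)` and `(e, v, u)` algebraically independent (sub-families)
  have hvu : AlgebraicIndependent ℚ (Fin.cons (pillayV u) ![u] : Fin 2 → ℂ) := by
    have h' := hg.comp ![(1 : Fin 4), 2] (by decide)
    have eq : (![e, pillayV u, u, cexp u] ∘ ![(1 : Fin 4), 2]) = (Fin.cons (pillayV u) ![u] : Fin 2 → ℂ) := by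
      funext i; fin_cases i <;> rfl
    rwa [eq] at h'
  have hevu : AlgebraicIndependent ℚ (Fin.cons e ![pillayV u, u] : Fin 3 → ℂ) := by
    have h' := hg.comp ![(0 : Fin 4), 1, 2] (by decide)
    have eq : (![e, pillayV u, u, cexp u] ∘ ![(0 : Fin 4), 1, 2]) = (Fin.cons e ![pillayV u, u] : Fin 3 → ℂ) := by
      funext i; fin_cases i <;> rfl
    rwa [eq] at h'
  have hR := linearIndependent_sq_self_one (transcendental_expE_of_schanuel hS)
  have huu : u ∈ adjoin ℚ (Set.range ![u]) := subset_adjoin ℚ _ ⟨0, by simp⟩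
  -- cons v R
  have h4 : LinearIndependent ℚ ![pillayV u, u ^ 2, u, (1 : ℂ)] := by
    refine linearIndependent_finCons.mpr ⟨hR, not_mem_span_of_not_isAlgebraic (S := Set.range ![u]) ?_
      (not_isAlgebraic_of_algebraicIndependent_cons hvu)⟩
    intro i; fin_cases i
    · simpa using pow_mem huu 2
    · simpa using huu
    · simp
  -- cons e (cons v R)
  refine linearIndependent_finCons.mpr ⟨h4, not_mem_span_of_not_isAlgebraic (S := Set.range ![pillayV u, u]) ?_
    (not_isAlgebraic_of_algebraicIndependent_cons hevu)⟩
  have hv' : pillayV u ∈ adjoin ℚ (Set.range ![pillayV u, u]) := subset_adjoin ℚ _ ⟨0, by simp⟩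
  have hu' : u ∈ adjoin ℚ (Set.range ![pillayV u, u]) := subset_adjoin ℚ _ ⟨1, by simp⟩
  intro i; fin_cases i
  · simpa using hv'
  · simpa using pow_mem hu' 2
  · simpa using hu'
  · simp

/-- S ⟹ `(e, u, v, e^u, e^v)` algebraically independent for `u = e^e` (Schanuel at `T = (e, v, u², u, 1)`). -/
theorem algInd_g₃_of_schanuel (hS : Literature.Periods.SchanuelConjecture) :
    AlgebraicIndependent ℚ (Fin.cons (cexp 1)
      ![cexp (cexp 1), pillayV (cexp (cexp 1)), cexp (cexp (cexp 1)), cexp (pillayV (cexp (cexp 1)))] : Fin 5 → ℂ) := by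
  have heK : cexp 1 ∈ adjoin ℚ (Set.range (Fin.cons (cexp 1)
      ![cexp (cexp 1), pillayV (cexp (cexp 1)), cexp (cexp (cexp 1)), cexp (pillayV (cexp (cexp 1)))] : Fin 5 → ℂ)) :=
    subset_adjoin ℚ _ ⟨0, rfl⟩
  have huK : cexp (cexp 1) ∈ adjoin ℚ (Set.range (Fin.cons (cexp 1)
      ![cexp (cexp 1), pillayV (cexp (cexp 1)), cexp (cexp (cexp 1)), cexp (pillayV (cexp (cexp 1)))] : Fin 5 → ℂ)) :=
    subset_adjoin ℚ _ ⟨1, rfl⟩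
  have hvK : pillayV (cexp (cexp 1)) ∈ adjoin ℚ (Set.range (Fin.cons (cexp 1)
      ![cexp (cexp 1), pillayV (cexp (cexp 1)), cexp (cexp (cexp 1)), cexp (pillayV (cexp (cexp 1)))] : Fin 5 → ℂ)) :=
    subset_adjoin ℚ _ ⟨2, rfl⟩
  have heuK : cexp (cexp (cexp 1)) ∈ adjoin ℚ (Set.range (Fin.cons (cexp 1)
      ![cexp (cexp 1), pillayV (cexp (cexp 1)), cexp (cexp (cexp 1)), cexp (pillayV (cexp (cexp 1)))] : Fin 5 → ℂ)) :=
    subset_adjoin ℚ _ ⟨3, rfl⟩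
  have hevK : cexp (pillayV (cexp (cexp 1))) ∈ adjoin ℚ (Set.range (Fin.cons (cexp 1)
      ![cexp (cexp 1), pillayV (cexp (cexp 1)), cexp (cexp (cexp 1)), cexp (pillayV (cexp (cexp 1)))] : Fin 5 → ℂ)) :=
    subset_adjoin ℚ _ ⟨4, rfl⟩
  refine algebraicIndependent_of_schanuel hS (linearIndependent_T_of_schanuel hS) ?_ ?_
  · intro i; fin_cases i
    · simpa using heK
    · simpa using hvK
    · simpa using pow_mem huK 2
    · simpa using huK
    · simp
  · intro i; fin_cases i
    · simpa using huK
    · simpa using hevK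
    · simpa [exp_sq_eq] using add_mem (mul_mem huK heuK) hvK
    · simpa using heuK
    · simpa using heK

/-- **`Schanuel ⟹ PillayHyp (e^e)`.** -/
theorem pillayHyp_expE_of_schanuel (hS : Literature.Periods.SchanuelConjecture) : AlgebraicIndependent ℚ
      ![cexp (cexp 1), pillayV (cexp (cexp 1)), cexp (cexp (cexp 1)), cexp (pillayV (cexp (cexp 1)))] := by
  have h := (algInd_g₃_of_schanuel hS).comp Fin.succ (Fin.succ_injective _)
  exact h

/-- S ⟹ `e` is transcendental over `F = ℚ(u, v, e^u, e^v)`, `u = e^e`. -/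
theorem e_not_isAlgebraic_over_F_of_schanuel (hS : Literature.Periods.SchanuelConjecture) :
    ¬ IsAlgebraic ↥(adjoin ℚ (Set.range
      ![cexp (cexp 1), pillayV (cexp (cexp 1)), cexp (cexp (cexp 1)), cexp (pillayV (cexp (cexp 1)))])) (cexp 1) :=
  not_isAlgebraic_of_algebraicIndependent_cons (algInd_g₃_of_schanuel hS)

end Summit.Schanuel.Schanuel.Theorems.RootDecomp1ModularLayer

end
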